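/-
Copyright: statement-level skeleton of a published paper (lit-balaban cell, Phase-2 proof seat p13, gen 13). No proof
claims beyond what the kernel checks below.
-/
import Literature.MathematicalPhysics.QuantumFieldTheory.BalabanImbrieJaffe1984to88.BIJ88WickSourceSmooth305
import Literature.Probability.LatticeModels.UrsellConnectedDiagrams

/-!
# `BalabanImbrieJaffe1984to88.BIJ88TruncationConnected306` — T. Bałaban, J. Imbrie, A. Jaffe, *Effective action and
cluster properties of the abelian Higgs model*, Commun. Math. Phys. **114** (1988) 257–315 [BalabanImbrieJaffe1988],
§5.13 p. 305 l.‐1 – p. 306 l.3 [PDF 49–50]: **"We integrate by parts all fields appearing in this formula. Each Φ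
contracts through a C_s to another Φ, to an f(□_i) or to ℱ.  If a closed loop forms, or if a train of covariances
beginning and ending in ℱ forms, then the term disappears with truncation."**

THE GAUSSIAN INSTANCE OF "TRUNCATION = CONNECTED DIAGRAMS".  Vertices: clusters `j : J`, each the monomial
`X_j(Φ) = Π_{l : own l = j} ⟨Φ, v_l⟩` in the fields (legs `l : Λ`, vectors `v_l`), and one smooth observable `H` (the
product of the `f(□_i)`); the measure is the finite-dimensional Gaussian `dμ = e^{−½⟨Φ,AΦ⟩}e^{⟨ℱ,Φ⟩}dΦ` (`C = A⁻¹`,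
source `ℱ = f`) of `BIJ88WickSource305`.  For a vertex family `P : Finset (Option J)` (`none` = the observable) the
normalized moment is `gmoment P = ⟨Π_{l ∈ legs P}⟨Φ,v_l⟩ · H^{[none ∈ P]}⟩`.

* `gmoment_eq_dmoment` — **complete contraction**: `gmoment = LegDiagram.dmoment own gw gω` — the moments ARE the
  diagram moments of `Literature.Probability.LatticeModels.UrsellConnectedDiagrams` with block weights
  `gw {l} = ⟨Cv_l,ℱ⟩` (a field contracted *"to ℱ"*), `gw {l,l'} = ⟨Cv_l,v_{l'}⟩` (*"to another Φ"*), `gw B = 0` for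
  `|B| ≥ 3`, and observable weights `gω D = ⟨∂_{Cv_D}H⟩` (the legs of `D` contracted *"to an f(□_i)"*).  This is
  `BIJ88WickSourceSmooth305.wick_source_smooth` (`none ∈ P`) / `BIJ88WickSource305.wick_source_expect` (`none ∉ P`)
  read through `LegDiagram.sum_diags`.
* `ursellOf_gmoment` — **"the term disappears with truncation" unless the diagram is connected**: for `V` nonempty,
  `ursellOf gmoment V = Σ_{g ∈ diags V, IsConn V g} dval g`; in particular, in the joint truncation of the `X_j`
  (`j ∈ V`) and `H`, every diagram with a component not containing the observable — a closed loop of propagators, or a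
  train beginning and ending in ℱ — is absent (`LegDiagram.ursellOf_dmoment`).

statement-level skeleton of published theorems with citation tags; proofs where landed; nothing here is a claim
about the Yang–Mills mass gap

PDF held: `paper:balaban1988-cmp114-bij-abelian-higgs-effective-action` (journal page = PDF page + 256).

CITATION HEADER (lean-in-tree rule).  lit-balaban cell (HOME `run/shared/lean/pub/lit-balaban/`), Phase 2, seat p13
gen 13; row **C2.Eq5.13.3-5.13.4** of `HOME/lit-balaban-r16/ROWS-C2-part2.md` (owner r16, referee ref-5), second clause
of the flip condition (post-integration-by-parts form at every order), step (ii) of the p13 HANDOFF roadmap.  USED BY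
NAME, nothing restated: p13 g12 `BIJ88WickSourceSmooth305.{dset, wick_source_smooth}`, `BIJ88WickSource305.{cweight,
wick_source_expect}`, `BIJ88PairingAllOrders5133.{smallParts, mem_smallParts}`, `BIJ88SDerivative305.
integral_weight_mul_source_pos`; p13 g13 `Literature.Probability.LatticeModels.LegDiagram.{legs, diags, dval, dmoment,
sum_diags, IsConn, ursellOf_dmoment}`.

## What is proved (0 `sorry`, standard axioms, no new `Prop` facts)

* defs `gexp` (normalized expectation), `gobs`, `gmoment`, `gw`, `gω`; `prod_gw_eq(_zero)`, `sum_setPartitions_prod_gw`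
  (partitions with a block of size ≥ 3 drop out: Wick pairings with source);
* **`gmoment_eq_dmoment`**, **`ursellOf_gmoment`**.
HONEST SCOPE.  Finite-dimensional real Gaussian with linear term; vertices = monomials in linear fields (the block
vertices `ΦᵀM_BΦ = Σ_x Φ(e_x)Φ(M_Bᵀe_x)` of (5.13.3) are sums of such — linearity in the clusters is
`LatticeModels.ursellOf_piFinset`, the identification of the connected two-leg diagrams with the trains of (5.13.3) is
NOT in this file).  NOT summit progress; NOT continuum; NOT Clay.
-/

noncomputable section

namespace Literature.MathematicalPhysics.QuantumFieldTheory.BalabanImbrieJaffe1984to88.BIJ88TruncationConnected306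

open MeasureTheory Matrix Finset
open scoped BigOperators
open Literature.Probability.LatticeModels (ursellOf setPartitions IsSetPartition mem_setPartitions)
open Literature.Probability.LatticeModels.LegDiagram (legs mem_legs diags dval dmoment sum_diags IsConn
  ursellOf_dmoment)
open Literature.MathematicalPhysics.QuantumFieldTheory.Balaban1983to89
open B2Eq228Conditioning (weight source)
open BIJ88PairingAllOrders5133 (smallParts mem_smallParts)
open BIJ88WickSource305 (cweight wick_source_expect)
open BIJ88WickSourceSmooth305 (dset wick_source_smooth)
open BIJ88SDerivative305 (integral_weight_mul_source_pos)

variable {S : Type} [Fintype S] [DecidableEq S] {J : Type} [DecidableEq J] {Λ : Type} [Fintype Λ] [LinearOrder Λ]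

/-! ## §1  Normalized expectations, the moments of the leg monomials and the observable -/

/-- The normalized Gaussian expectation `⟨G⟩ = ∫ G dμ / ∫ dμ`, `dμ = e^{−½⟨Φ,AΦ⟩}e^{⟨ℱ,Φ⟩}dΦ`.
[cite: BalabanImbrieJaffe1988, §5.13 p.305] -/
def gexp (A : Matrix S S ℝ) (f : S → ℝ) (G : (S → ℝ) → ℝ) : ℝ :=
  (∫ φ : S → ℝ, G φ * (weight A φ * source f φ)) / ∫ φ : S → ℝ, weight A φ * source f φ

/-- The random variable of a vertex family `P`: the product of the fields of the legs of its clusters, times the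
observable `H` if `none ∈ P`. [cite: BalabanImbrieJaffe1988, §5.13 p.305] -/
def gobs (own : Λ → J) (v : Λ → S → ℝ) (H : (S → ℝ) → ℝ) (P : Finset (Option J)) (φ : S → ℝ) : ℝ :=
  (∏ l ∈ legs own P, φ ⬝ᵥ v l) * (if none ∈ P then H φ else 1)

/-- **Moments of the leg monomials and the observable**: `gmoment P = ⟨Π_{l ∈ legs P}⟨Φ,v_l⟩ · H^{[none∈P]}⟩`.
[cite: BalabanImbrieJaffe1988, §5.13 p.305] -/
def gmoment (A : Matrix S S ℝ) (f : S → ℝ) (own : Λ → J) (v : Λ → S → ℝ) (H : (S → ℝ) → ℝ)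
    (P : Finset (Option J)) : ℝ :=
  gexp A f (gobs own v H P)

/-- **Block weights of the complete contraction**: `w_{{l}} = ⟨Cv_l,ℱ⟩` (*"to ℱ"*), `w_{{l,l'}} = ⟨Cv_l,v_{l'}⟩` (*"to
another Φ"*), larger blocks `0` (Wick). [cite: BalabanImbrieJaffe1988, §5.13 p.305] -/
def gw (A : Matrix S S ℝ) (f : S → ℝ) (v : Λ → S → ℝ) (B : Finset Λ) : ℝ :=
  if B.card ≤ 2 then cweight A f v B else 0

/-- **Observable weights**: `ω_D = ⟨∂_{Cv_D}H⟩` — the legs of `D` contracted *"to an f(□_i)"*.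
[cite: BalabanImbrieJaffe1988, §5.13 p.305] -/
def gω (A : Matrix S S ℝ) (f : S → ℝ) (v : Λ → S → ℝ) (H : (S → ℝ) → ℝ) (D : Finset Λ) : ℝ :=
  gexp A f (dset (fun l => A⁻¹ *ᵥ v l) D H)

omit [Fintype Λ] in
/-- A partition with a block of three or more legs has weight `0`. [cite: BalabanImbrieJaffe1988, §5.13 p.305] -/
theorem prod_gw_eq_zero (A : Matrix S S ℝ) (f : S → ℝ) (v : Λ → S → ℝ) {τ : Finset (Finset Λ)}
    (h : ¬ ∀ B ∈ τ, B.card ≤ 2) : ∏ B ∈ τ, gw A f v B = 0 := by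
  simp only [not_forall, not_le, exists_prop] at h
  obtain ⟨B, hB, hBc⟩ := h
  exact prod_eq_zero hB (if_neg (not_le.2 hBc))

omit [Fintype Λ] in
/-- On small partitions the weights are the contraction weights. [cite: BalabanImbrieJaffe1988, §5.13 p.305] -/
theorem prod_gw_eq (A : Matrix S S ℝ) (f : S → ℝ) (v : Λ → S → ℝ) {τ : Finset (Finset Λ)}
    (h : ∀ B ∈ τ, B.card ≤ 2) : ∏ B ∈ τ, gw A f v B = ∏ B ∈ τ, cweight A f v B :=
  prod_congr rfl fun B hB => if_pos (h B hB)

/-- Summing the weights over all set partitions of a leg set is summing the contraction weights over its partitions into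
singletons and pairs. [cite: BalabanImbrieJaffe1988, §5.13 p.305] -/
theorem sum_setPartitions_prod_gw (A : Matrix S S ℝ) (f : S → ℝ) (v : Λ → S → ℝ) (T : Finset Λ) :
    ∑ τ ∈ setPartitions T, ∏ B ∈ τ, gw A f v B = ∑ σ ∈ smallParts T, ∏ B ∈ σ, cweight A f v B := by
  rw [smallParts, sum_filter]
  refine sum_congr rfl fun τ _ => ?_
  split_ifs with h
  · exact prod_gw_eq A f v h
  · exact prod_gw_eq_zero A f v h

/-! ## §2  The moments are the diagram moments; truncation keeps the connected diagrams -/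

section Main

variable (A : Matrix S S ℝ) (f : S → ℝ) (own : Λ → J) (v : Λ → S → ℝ)
  (𝒞 : ((S → ℝ) → ℝ) → Prop)
  (hC : ∀ G, 𝒞 G → ContDiff ℝ 1 G ∧ (∃ K₀ : ℝ, ∀ φ, ‖G φ‖ ≤ K₀) ∧ ∃ K₁ : ℝ, ∀ φ, ‖fderiv ℝ G φ‖ ≤ K₁)
  (hD : ∀ G (u : S → ℝ), 𝒞 G → 𝒞 (fun φ => fderiv ℝ G φ u)) {H : (S → ℝ) → ℝ} (hH : 𝒞 H)

include hC hD hH in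
/-- **COMPLETE CONTRACTION — THE MOMENTS ARE THE DIAGRAM MOMENTS**: *"Each Φ contracts through a C_s to another Φ, to
an f(□_i) or to ℱ"* — for every vertex family `P`,
`⟨Π_{l∈legs P}⟨Φ,v_l⟩ · H^{[none∈P]}⟩ = Σ_{(D,τ) ∈ diags P} (Π_{B∈τ} w_B) · ⟨∂_{Cv_D}H⟩^{[none∈P]}` with the weights
`gw`, `gω` (Wick's theorem with source and smooth factor, `wick_source_smooth` / `wick_source_expect`).
[cite: BalabanImbrieJaffe1988, §5.13 p.305] -/
theorem gmoment_eq_dmoment (hA : A.PosDef) (P : Finset (Option J)) :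
    gmoment A f own v H P = dmoment own (gw A f v) (gω A f v H) P := by
  have hZ : (∫ φ : S → ℝ, weight A φ * source f φ) ≠ 0 := (integral_weight_mul_source_pos hA f).ne'
  rw [dmoment, sum_diags]
  by_cases hn : none ∈ P
  · -- the observable is present: Wick with source and smooth factor
    have hobs : gobs own v H P = fun φ => (∏ l ∈ legs own P, φ ⬝ᵥ v l) * H φ := by
      funext φ
      rw [gobs, if_pos hn]
    rw [gmoment, gexp, hobs,
      filter_true_of_mem (s := (legs own P).powerset) (p := fun D => D.Nonempty → none ∈ P) fun D _ _ => hn]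
    simp only
    rw [wick_source_smooth A hA f v 𝒞 hC hD (legs own P) H hH, sum_div]
    refine sum_congr rfl fun D _ => ?_
    simp only [dval, if_pos hn]
    rw [← sum_mul, sum_setPartitions_prod_gw, gω, gexp, mul_div_assoc]
  · -- no observable: only `D = ∅`, plain Wick with source
    have hobs : gobs own v H P = fun φ => ∏ l ∈ legs own P, φ ⬝ᵥ v l := by
      funext φ
      rw [gobs, if_neg hn, mul_one]
    have hfilt : (legs own P).powerset.filter (fun D => D.Nonempty → none ∈ P) = {∅} := by
      ext D
      simp only [mem_filter, mem_powerset, mem_singleton]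
      constructor
      · rintro ⟨-, h⟩
        exact not_nonempty_iff_eq_empty.1 fun hD => hn (h hD)
      · rintro rfl
        exact ⟨empty_subset _, fun h => absurd h not_nonempty_empty⟩
    rw [gmoment, gexp, hobs, hfilt, sum_singleton, sdiff_empty]
    simp only [dval, if_neg hn, mul_one]
    rw [wick_source_expect A hA f v (legs own P), sum_setPartitions_prod_gw]

include hC hD hH in
/-- **"IF A CLOSED LOOP FORMS, OR IF A TRAIN OF COVARIANCES BEGINNING AND ENDING IN ℱ FORMS, THEN THE TERM DISAPPEARS
WITH TRUNCATION"**: the joint truncated expectation (Ursell function) of the cluster monomials `X_j` (`some j ∈ V`) and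
the observable `H` (if `none ∈ V`) is the sum over the CONNECTED complete contractions only,
`⟨X_{j₁}; …; X_{j_k}; H⟩ᵀ = Σ_{(D,τ) ∈ diags V, connected} (Π_{B∈τ} w_B) · ⟨∂_{Cv_D}H⟩^{[none∈V]}` — a diagram with a
component avoiding the observable (a closed loop of propagators, or a train from ℱ to ℱ) does not occur.
[cite: BalabanImbrieJaffe1988, §5.13 p.306] -/
theorem ursellOf_gmoment (hA : A.PosDef) {V : Finset (Option J)} (hV : V.Nonempty) :
    ursellOf (gmoment A f own v H) V
      = ∑ g ∈ (diags own V).filter (IsConn own V), dval (gw A f v) (gω A f v H) V g := by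
  have h : gmoment A f own v H = dmoment own (gw A f v) (gω A f v H) :=
    funext fun P => gmoment_eq_dmoment A f own v 𝒞 hC hD hH hA P
  rw [h]
  exact ursellOf_dmoment (gw A f v) (gω A f v H) hV

end Main

end Literature.MathematicalPhysics.QuantumFieldTheory.BalabanImbrieJaffe1984to88.BIJ88TruncationConnected306
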